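import Literature.AlgebraicGeometry.Resolution.LocalUniformizationAbhyankarPlacesProofs
import Literature.AlgebraicGeometry.Resolution.ValuedFunctionFields
import Literature.AlgebraicGeometry.Resolution.SubfieldTransport
import HarnessLib

/-!
# Transport of the Abhyankar property between abstract residue fields (`stub_isAbhyankarPlace_residue_transport`)

Stub of the birth line of the crux `ShadowsUniformize` (stmt-ResolutionOfSingularities-16756, route
`AbhyankarShadows`), composite-uniformizable branch (lead c3). In the Novacoski–Spivakovsky
decomposition `ν = ν₁ ∘ ν₂` of a rational valuation ring `O` of a function field `K/k` along a
coarsening `O ≤ O₁`, the residue valuation `ν₂` has a valuation ring `W` inside the residue field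
`L := κ(O₁)`. The composition lemma (`stub_lurel_of_composite`) hands over an ABSTRACT field `κ'`
with a `k`-algebra structure and a `k`-compatible surjective (hence bijective) homomorphism
`ι' : κ' → L`, while the hypothesis "the residue valuation is an Abhyankar place of the residue
function field over `k`" is stated for ANOTHER such pair `(κ, ι)`. This file moves the Abhyankar
property from `(κ, ι)` to `(κ', ι')`; nothing about `O` is needed — it is pure transport.

Setting: fields `k, κ, κ', L`, `k`-algebra structures on `κ, κ'`, a valuation subring `W ≤ L`,
surjective ring homomorphisms `ι : κ → L`, `ι' : κ' → L` with `ι ∘ algebraMap k κ =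
ι' ∘ algebraMap k κ'`.

Claim: if `W.comap ι` is an Abhyankar place of `κ | k` (`IsAbhyankarPlace (W.comap ι)
(algebraMap k κ).fieldRange ⊤`), then `W.comap ι'` is an Abhyankar place of `κ' | k`.

Proof: `ι'` is a bijection, so `e := ι'⁻¹ ∘ ι : κ →+* κ'` is a (surjective) field homomorphism
with `ι' ∘ e = ι`; hence `(W.comap ι').comap e = W.comap ι` (`ValuationSubring.mem_comap`),
`e` maps `(algebraMap k κ).fieldRange` onto `(algebraMap k κ').fieldRange` (by the compatibility
`hcompat` and injectivity of `ι'`) and `⊤` onto `⊤` (surjectivity of `e`, from that of `ι`). The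
tree's transport lemma `isAbhyankarPlace_map e` (`LocalUniformizationAbhyankarPlacesProofs.lean`,
section `Transport`) concludes. No named facts are used.

## Sources

* [KK05] H. Knaf, F.-V. Kuhlmann, *Abhyankar places admit local uniformization in any
  characteristic*, Ann. Sci. École Norm. Sup. 38 (2005) 833–846: §1 (Abhyankar places).
  [KnafKuhlmann2005]
* [NS14] J. Novacoski, M. Spivakovsky, *Reduction of local uniformization to the rank one case*,
  2014: §2.1, Remark 2.4 (the decomposition `ν = ν₁ ∘ ν₂`). [NovacoskiSpivakovsky2014]
-/

noncomputable section

-- single-problem summit: the doubled namespace component is forced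
set_option linter.dupNamespace false

open Literature.AlgebraicGeometry.Resolution IsLocalRing

namespace Summit.ResolutionOfSingularities.ResolutionOfSingularities.Theorems

/-- **Transport of the Abhyankar property between abstract residue fields.** For surjective
field homomorphisms `ι : κ → L`, `ι' : κ' → L` compatible with the `k`-algebra structures,
`e := ι'⁻¹ ∘ ι : κ → κ'` satisfies `(W.comap ι').comap e = W.comap ι`, maps
`(algebraMap k κ).fieldRange` onto `(algebraMap k κ').fieldRange` and `⊤` onto `⊤`; conclude by
`isAbhyankarPlace_map e`. [folklore] -/
theorem stub_isAbhyankarPlace_residue_transport (k κ κ' L : Type) [Field k] [Field κ] [Field κ']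
    [Field L] [Algebra k κ] [Algebra k κ'] (W : ValuationSubring L) (ι : κ →+* L) (ι' : κ' →+* L)
    (hι : Function.Surjective ι) (hι' : Function.Surjective ι')
    (hcompat : ∀ c : k, ι (algebraMap k κ c) = ι' (algebraMap k κ' c))
    (hA : IsAbhyankarPlace (W.comap ι) (algebraMap k κ).fieldRange ⊤) :
    IsAbhyankarPlace (W.comap ι') (algebraMap k κ').fieldRange ⊤ := by
  -- the `k`-compatible isomorphism `e := ι'⁻¹ ∘ ι : κ → κ'`
  let e' : κ' ≃+* L := RingEquiv.ofBijective ι' ⟨ι'.injective, hι'⟩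
  let e : κ →+* κ' := e'.symm.toRingHom.comp ι
  have he : ∀ x : κ, ι' (e x) = ι x := fun x =>
    (RingEquiv.ofBijective_apply ι' _ (e'.symm (ι x))).symm.trans (e'.apply_symm_apply (ι x))
  have hes : Function.Surjective e := fun y => by
    obtain ⟨x, hx⟩ := hι (ι' y)
    exact ⟨x, ι'.injective ((he x).trans hx)⟩
  have hek : ∀ c : k, e (algebraMap k κ c) = algebraMap k κ' c := fun c =>
    ι'.injective ((he _).trans (hcompat c))
  -- compatibility with the valuation rings
  have hV : (W.comap ι').comap e = W.comap ι := by
    ext x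
    simp only [ValuationSubring.mem_comap, he]
  -- the images of the constant field and of the whole field
  have hK : ((algebraMap k κ).fieldRange).map e = (algebraMap k κ').fieldRange := by
    ext y
    simp only [Subfield.mem_map, RingHom.mem_fieldRange]
    constructor
    · rintro ⟨_, ⟨c, rfl⟩, rfl⟩
      exact ⟨c, (hek c).symm⟩
    · rintro ⟨c, rfl⟩
      exact ⟨algebraMap k κ c, ⟨c, rfl⟩, hek c⟩
  have hF : (⊤ : Subfield κ).map e = ⊤ := by
    ext y
    simp only [Subfield.mem_map, Subfield.mem_top, true_and, iff_true]
    exact hes y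
  have h := isAbhyankarPlace_map e hV hA
  rwa [hK, hF] at h

end Summit.ResolutionOfSingularities.ResolutionOfSingularities.Theorems

end
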